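import Summits.Ventures.CertifiedArithmetic.LowPrec.GemmFirstRegimeSpineZ
import Summits.Ventures.CertifiedArithmetic.LowPrec.GemmFirstRegimeLawRows
import HarnessLib

/-!
# GEMM worst case LXIV-c — THE EXACT LAW ON THE WHOLE FIRST REGIME `k ≤ 2^(p-1)`:
# `R(x, n₀ + k) ≤ max(k/(B+k), (k-1)/(T+k-1))` without (H1), and the rows for E2M1²,
# E2M3·E2M1 and E3M2·E2M1 into binary32

HONEST FRAMING: certified error envelopes and provably optimal rounding/accumulation schemes for
low-precision formats under stated cost models; every table by two implementations; no hardware or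
vendor claims.

Setting of files LXII-a/LXIII-a/b (grid alphabet `x j = z_j/2^G`, `|z_j| ≤ M`, odd only when
`|z_j| ≤ m₀`; `T = 2^(manBits+1)`; exact prefix `M j₀ + m₀ < T`; `M(j₀+2) + Q = 2T`; entry-mass
hypothesis `H_B`).  THEOREM (`relErr_le_firstRegimeLaw_all`, gemm.tex Prop. p:fpL without the
top-sliver caveat): for EVERY word and every `k = d + 1 ≤ T/2`, provided `Q ≥ M + 2` and
`manBits ≥ 1`, `R(x, j₀+1+d) ≤ max((d+1)/(B+d+1), d/(T+d))`.

* LOW words: file LXIII-a verbatim (`lowInvG_of_low`, `relErr_le_of_lowInvG`).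
* HIGH words: THE BRIDGE `toRat_seqSum_eq_accZ` — by the a-priori growth
  `|ŝ_{j₀+t}| ≤ (M(j₀+1) + 2Mt)/2^G` (`abs_seqSum_le_growth`) no argument leaves the finite range
  (`< 2^(manBits+E+3)`, `M ≤ 2^(G+E)`), so every step is the integer RNE of file XLIX-b
  (`toRat_roundNE_grid_prec`) and `ŝ_i = accZ i / 2^G`; the hypotheses of the spine theorem
  (file LXIV-b) are read off (`Q ≥ M + 2` makes the two arguments after the exact prefix `< 2T`),
  and `spineZ_abs` gives `(T+d)|ŝ_n - s_n| ≤ d L_n`.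
* ROWS (`H_B` by the deficit automaton of file LXIII-c, lower bounds by the families of files
  LX/LXI): E2M1², `p ≥ 13`, `p ≡ 1, 2 (mod 6)` (`worstP_firstRegimeLaw_one_all/_two_all`):
  `W_p(n₀+k) = max(k/(B+k), (k-1)/(T+k-1))` for EVERY `1 ≤ k ≤ 2^(p-1)`; E2M3·E2M1, E3M2·E2M1
  into binary32 (`worst4P/5P_Binary32_law_all`): the same for every `1 ≤ k ≤ 2^23`.

References: [Higham2002, §4.2], [IEEE7542019, §4.3.1], [LangeRump2019], [BoldoEtAl2023, Thm 4.5],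
[RouhaniEtAl2023MX, Table 1].
-/

namespace Summit.Ventures.CertifiedArithmetic.LowPrec.Gemm

open Literature.ComputerArithmetic.FloatingPoint
open Literature.ComputerArithmetic.FloatingPoint.MiniFloat
open Literature.ComputerArithmetic.JeannerodRump2018
open Finset

variable {φ : Format}

section Grid

variable {G M m0 E : ℕ} {x : ℕ → ℚ}
  (hx : ∀ j, ∃ z : ℤ, x j = (z : ℚ) / 2 ^ G ∧ z.natAbs ≤ M ∧ (z % 2 = 0 ∨ z.natAbs ≤ m0))
  (hq : φ.qexp ≤ -(G : ℤ)) (hR : (2 : ℚ) ^ (φ.manBits + E + 3) ≤ φ.maxRat)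
  (hm0M : m0 ≤ M) (hMT : M ≤ 2 ^ (φ.manBits + 1)) (hm0 : 1 ≤ m0) (hME : M ≤ 2 ^ (G + E))
include hx hq hR hm0M hMT hm0 hME

omit hm0 in
/-- THE BRIDGE: in the first regime (`d + 1 ≤ T/2`) every accumulator `ŝ_i`, `i ≤ j₀+1+d`, is the
integer model's `accZ i / 2^G` (no step leaves the finite range). [cell] -/
theorem toRat_seqSum_eq_accZ {j0 Q d : ℕ} (hj0 : M * j0 + m0 < 2 ^ (φ.manBits + 1))
    (hQ : M * (j0 + 2) + Q = 2 * 2 ^ (φ.manBits + 1)) (hd : d + 1 ≤ 2 ^ φ.manBits) :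
    ∀ i ≤ j0 + 1 + d, (seqSum φ x i).toRat = (accZ φ.manBits (zl G x) i : ℚ) / 2 ^ G := by
  have hGpos : (0 : ℚ) < 2 ^ G := by positivity
  have hR' : (2 : ℚ) ^ (φ.manBits + (E + 3)) ≤ φ.maxRat := by rwa [← add_assoc]
  -- the range bound in grid units
  have hbig : M * (j0 + 2) + 2 * (M * (d + 1)) < 2 ^ (φ.manBits + (E + 3) + G) := by
    have h1 : M * (d + 1) ≤ 2 ^ (G + E) * 2 ^ φ.manBits := Nat.mul_le_mul hME hd
    have h2 : 2 ^ (G + E) * 2 ^ φ.manBits = 2 ^ (G + E + φ.manBits) := by rw [← pow_add]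
    have h3 : 2 ^ φ.manBits ≤ 2 ^ (G + E + φ.manBits) :=
      Nat.pow_le_pow_right (by norm_num) (by omega)
    have h4 : 2 ^ (φ.manBits + (E + 3) + G) = 8 * 2 ^ (G + E + φ.manBits) := by
      rw [show φ.manBits + (E + 3) + G = (G + E + φ.manBits) + 3 by omega, pow_add]; ring
    have h5 : 2 ^ (φ.manBits + 1) = 2 * 2 ^ φ.manBits := by rw [pow_succ]; ring
    omega
  have hMj : M ≤ M * (j0 + 2) + 2 * (M * (d + 1)) :=
    le_trans (Nat.le_mul_of_pos_right M (by omega)) (Nat.le_add_right _ _)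
  have hxz := zl_spec hx
  intro i
  induction i with
  | zero =>
      intro _
      obtain ⟨hz, hzM, -⟩ := hxz 0
      show (roundNE φ (x 0)).toRat = (rneZ φ.manBits (zl G x 0) : ℚ) / 2 ^ G
      rw [hz]
      exact toRat_roundNE_grid_prec hq _
        (grid_le_maxRat_of_lt hR' (lt_of_le_of_lt (le_trans hzM hMj) hbig))
  | succ i ih =>
      intro hi
      have ih' := ih (by omega)
      obtain ⟨hz, hzM, -⟩ := hxz (i + 1)
      show (roundNE φ ((seqSum φ x i).toRat + x (i + 1))).toRat
        = (rneZ φ.manBits (accZ φ.manBits (zl G x) i + zl G x (i + 1)) : ℚ) / 2 ^ G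
      have hsum : (seqSum φ x i).toRat + x (i + 1)
          = ((accZ φ.manBits (zl G x) i + zl G x (i + 1) : ℤ) : ℚ) / 2 ^ G := by
        rw [ih', hz]; push_cast; ring
      rw [hsum]
      refine toRat_roundNE_grid_prec hq _ (grid_le_maxRat_of_lt hR' (lt_of_le_of_lt ?_ hbig))
      -- `|ŝ_i + x_{i+1}| · 2^G ≤ M(j₀+2) + 2M(d+1)`
      apply natAbs_le_of_abs_cast_le
      have habs : |(((accZ φ.manBits (zl G x) i + zl G x (i + 1) : ℤ) : ℚ))|
          = |(seqSum φ x i).toRat + x (i + 1)| * 2 ^ G := by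
        rw [hsum, abs_div, abs_of_pos hGpos, div_mul_cancel₀ _ (ne_of_gt hGpos)]
      rw [habs]
      have h1 := abs_add_le (seqSum φ x i).toRat (x (i + 1))
      have h2 : |x (i + 1)| ≤ (M : ℚ) / 2 ^ G := by
        rw [hz, abs_div, abs_of_pos hGpos, ← Int.cast_abs, Int.abs_eq_natAbs, Int.cast_natCast]
        exact div_le_div_of_nonneg_right (by exact_mod_cast hzM) hGpos.le
      -- `|ŝ_i| ≤ (M(j₀+1) + 2M(d+1))/2^G`
      have h3 : |(seqSum φ x i).toRat|
          ≤ ((M : ℚ) * ((j0 + 1 : ℕ) : ℚ) + 2 * M * ((d + 1 : ℕ) : ℚ)) / 2 ^ G := by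
        rcases le_or_gt i j0 with hij | hij
        · rw [seqSum_exact_prefixG hx hq hR hm0M hMT hj0 i hij]
          refine le_trans (abs_sum_le_sum_abs _ _) (le_trans (sum_abs_leG hx (i + 1)) ?_)
          rw [div_mul_eq_mul_div]
          apply div_le_div_of_nonneg_right _ hGpos.le
          have : ((i + 1 : ℕ) : ℚ) ≤ ((j0 + 1 : ℕ) : ℚ) := by
            exact_mod_cast (by omega : i + 1 ≤ j0 + 1)
          have hM0 : (0 : ℚ) ≤ M := Nat.cast_nonneg M
          push_cast at this ⊢
          nlinarith
        · obtain ⟨t, rfl⟩ : ∃ t, i = j0 + t := ⟨i - j0, by omega⟩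
          refine le_trans (abs_seqSum_le_growth hx hq hR hm0M hMT hj0 t) ?_
          apply div_le_div_of_nonneg_right _ hGpos.le
          have : (t : ℚ) ≤ ((d + 1 : ℕ) : ℚ) := by exact_mod_cast (by omega : t ≤ d + 1)
          have hM0 : (0 : ℚ) ≤ M := Nat.cast_nonneg M
          nlinarith
      have e : (((M * (j0 + 2) + 2 * (M * (d + 1)) : ℕ) : ℚ))
          = (((M : ℚ) * ((j0 + 1 : ℕ) : ℚ) + 2 * M * ((d + 1 : ℕ) : ℚ)) / 2 ^ G + (M : ℚ) / 2 ^ G)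
            * 2 ^ G := by
        field_simp; push_cast; ring
      rw [e]
      exact mul_le_mul_of_nonneg_right (by linarith) hGpos.le

/-- THE EXACT LAW ON THE WHOLE FIRST REGIME `k = d + 1 ≤ T/2 = 2^(manBits φ)`, every grid alphabet
and precision with `Q ≥ M + 2`: `R(x, j₀+1+d) ≤ max((d+1)/(B+d+1), d/(T+d))` for EVERY word — the
top-sliver hypothesis (H1) of `relErr_le_firstRegimeLaw` is gone. [cell, gemm.tex Prop. p:fpL] -/
theorem relErr_le_firstRegimeLaw_all {j0 Bn Q d : ℕ} (hm : 1 ≤ φ.manBits)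
    (hj0 : M * j0 + m0 < 2 ^ (φ.manBits + 1))
    (hB : (∑ i ∈ range (j0 + 2), zl G x i) % 2 ≠ 0 →
      2 ^ (φ.manBits + 1) < (∑ i ∈ range (j0 + 2), zl G x i).natAbs →
      ((Bn : ℚ) + 1) / 2 ^ G ≤ ∑ i ∈ range (j0 + 2), |x i|)
    (hQ : M * (j0 + 2) + Q = 2 * 2 ^ (φ.manBits + 1)) (hQM : M + 2 ≤ Q)
    (hd : d + 1 ≤ 2 ^ φ.manBits) :
    relErr φ x (j0 + 1 + d) ≤ max (((d + 1 : ℕ) : ℚ) / ((Bn : ℚ) + ((d + 1 : ℕ) : ℚ)))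
      ((d : ℚ) / (2 ^ (φ.manBits + 1) + d)) := by
  classical
  have hGpos : (0 : ℚ) < 2 ^ G := by positivity
  have hmax0 : 0 ≤ max (((d + 1 : ℕ) : ℚ) / ((Bn : ℚ) + ((d + 1 : ℕ) : ℚ)))
      ((d : ℚ) / (2 ^ (φ.manBits + 1) + d)) :=
    le_trans (by positivity) (le_max_right _ _)
  -- EITHER the word is low up to `j₀ + d` (file LXIII-a) …
  by_cases hex : ∃ j, j0 ≤ j ∧ j < j0 + (d + 1) ∧
      2 ^ (φ.manBits + 2) / 2 ^ G ≤ |(seqSum φ x j).toRat + x (j + 1)|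
  swap
  · have hall : ∀ j, j0 ≤ j → j < j0 + (d + 1) →
        |(seqSum φ x j).toRat + x (j + 1)| < 2 ^ (φ.manBits + 2) / 2 ^ G :=
      fun j h1 h2 => lt_of_not_ge fun h => hex ⟨j, h1, h2, h⟩
    have h := lowInvG_of_low hx hq hR hm0M hMT hj0 hB (d + 1) hall
    rw [show j0 + (d + 1) = j0 + 1 + d by ring] at h
    exact relErr_le_of_lowInvG h
  -- … OR it is high: pass to the integer model `accZ` and apply the spine theorem
  obtain ⟨j, hj1, hj2, hj3⟩ := hex
  have hbr := toRat_seqSum_eq_accZ hx hq hR hm0M hMT hME hj0 hQ hd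
  have hxz := zl_spec hx
  have hV : ∀ i, i < j0 + 1 + d → (seqSum φ x i).toRat + x (i + 1)
      = ((accZ φ.manBits (zl G x) i + zl G x (i + 1) : ℤ) : ℚ) / 2 ^ G := by
    intro i hi
    rw [hbr i (by omega), (hxz (i + 1)).1]; push_cast; ring
  have hLsum : ∀ k, (∑ i ∈ range k, (zl G x i).natAbs) ≤ M * k := by
    intro k
    induction k with
    | zero => simp
    | succ k ih => rw [sum_range_succ, Nat.mul_succ]; exact Nat.add_le_add ih (hxz k).2.1
  have hsabs : ∀ k, (∑ i ∈ range (k + 1), zl G x i).natAbs ≤ M * (k + 1) := by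
    intro k
    have h1 := abs_sZ_le_LZ (zl G x) k
    unfold sZ LZ at h1
    rw [Int.abs_eq_natAbs, ← Nat.cast_sum] at h1
    have h3 : ((∑ i ∈ range (k + 1), zl G x i).natAbs : ℤ) ≤ ((M * (k + 1) : ℕ) : ℤ) :=
      le_trans h1 (by exact_mod_cast hLsum (k + 1))
    exact_mod_cast h3
  have hacc : ∀ i, i < j0 + 1 + d → accZ φ.manBits (zl G x) (i + 1)
      = rneZ φ.manBits (accZ φ.manBits (zl G x) i + zl G x (i + 1)) := fun i _ => rfl
  have hpre : accZ φ.manBits (zl G x) j0 = sZ (zl G x) j0 := by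
    have h1 := hbr j0 (by omega)
    rw [seqSum_exact_prefixG hx hq hR hm0M hMT hj0 j0 le_rfl, sum_eq_zlG hx j0,
      div_left_inj' (ne_of_gt hGpos)] at h1
    unfold sZ
    exact_mod_cast h1.symm
  have hs1 : (accZ φ.manBits (zl G x) j0 + zl G x (j0 + 1)).natAbs ≤ M * (j0 + 2) := by
    rw [hpre]; unfold sZ; rw [← sum_range_succ]; exact le_of_le_of_eq (hsabs (j0 + 1)) (by ring)
  have hT2N : 2 ^ (φ.manBits + 2) = 2 * 2 ^ (φ.manBits + 1) := by rw [pow_succ]; ring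
  have hV0 : (accZ φ.manBits (zl G x) j0 + zl G x (j0 + 1)).natAbs < 2 ^ (φ.manBits + 2) := by
    omega
  have hV1 : (accZ φ.manBits (zl G x) (j0 + 1) + zl G x (j0 + 1 + 1)).natAbs
      < 2 ^ (φ.manBits + 2) := by
    have h2 := rneZ_err_le (m := φ.manBits) 0
      (K := accZ φ.manBits (zl G x) j0 + zl G x (j0 + 1)) (by simpa using hV0)
    rw [← hacc j0 (by omega)] at h2
    have h3 := (hxz (j0 + 1 + 1)).2.1
    simp only [pow_zero] at h2
    omega
  have hδ : ∀ i, i < j0 + 1 + d → (accZ φ.manBits (zl G x) (i + 1)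
      - (accZ φ.manBits (zl G x) i + zl G x (i + 1))).natAbs ≤ (zl G x (i + 1)).natAbs := by
    intro i hi
    have h1 := abs_step_err_le_term (φ := φ) x i
    rw [hV i hi, hbr (i + 1) (by omega), (hxz (i + 1)).1, ← sub_div, abs_div, abs_div,
      abs_of_pos hGpos, div_le_div_iff_of_pos_right hGpos] at h1
    apply natAbs_le_of_abs_cast_le
    rw [Nat.cast_natAbs]
    push_cast
    exact_mod_cast h1
  have hhigh : ∃ i, j0 ≤ i ∧ i < j0 + 1 + d ∧
      2 ^ (φ.manBits + 2) ≤ (accZ φ.manBits (zl G x) i + zl G x (i + 1)).natAbs := by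
    refine ⟨j, hj1, by omega, le_natAbs_of_cast_le_abs ?_⟩
    rw [hV j (by omega), abs_div, abs_of_pos hGpos, div_le_div_iff_of_pos_right hGpos] at hj3
    exact_mod_cast hj3
  have hsp := spineZ_abs hm hd hacc hpre hV0 hV1 hδ hhigh
  -- back to `relErr`
  have hq' : ((2 : ℚ) ^ (φ.manBits + 1) + d)
      * |((accZ φ.manBits (zl G x) (j0 + 1 + d) - sZ (zl G x) (j0 + 1 + d) : ℤ) : ℚ)|
      ≤ (d : ℚ) * ((LZ (zl G x) (j0 + 1 + d) : ℤ) : ℚ) := by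
    exact_mod_cast hsp
  have e1 : ((LZ (zl G x) (j0 + 1 + d) : ℤ) : ℚ)
      = ((∑ i ∈ range (j0 + 1 + d + 1), (zl G x i).natAbs : ℕ) : ℚ) := by
    unfold LZ; rw [← Nat.cast_sum, Int.cast_natCast]
  have e2 : ((accZ φ.manBits (zl G x) (j0 + 1 + d) - sZ (zl G x) (j0 + 1 + d) : ℤ) : ℚ)
      = (accZ φ.manBits (zl G x) (j0 + 1 + d) : ℚ)
        - ((∑ i ∈ range (j0 + 1 + d + 1), zl G x i : ℤ) : ℚ) := by
    unfold sZ; push_cast; rfl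
  rw [e1, e2] at hq'
  unfold relErr
  rw [hbr (j0 + 1 + d) le_rfl, sum_eq_zlG hx (j0 + 1 + d), sum_abs_eq_natG hx (j0 + 1 + d + 1),
    ← sub_div, abs_div, abs_of_pos hGpos]
  by_cases hL : ((∑ i ∈ range (j0 + 1 + d + 1), (zl G x i).natAbs : ℕ) : ℚ) = 0
  · rw [hL, zero_div, div_zero]; exact hmax0
  have hLpos : (0 : ℚ) < ((∑ i ∈ range (j0 + 1 + d + 1), (zl G x i).natAbs : ℕ) : ℚ) :=
    lt_of_le_of_ne (Nat.cast_nonneg _) (Ne.symm hL)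
  rw [div_div_div_cancel_right₀ (ne_of_gt hGpos)]
  refine le_trans ?_ (le_max_right _ _)
  rw [div_le_iff₀ hLpos, div_mul_eq_mul_div, le_div_iff₀ (by positivity)]
  linarith

end Grid

/-! ### Rows on the whole first regime -/

section RowsAll

variable {G M m0 E : ℕ} {φ : Format} {L : ℚ → Prop} {W : ℕ → ℚ}
variable
  (hL : ∀ q, L q → ∃ z : ℤ, q = (z : ℚ) / 2 ^ G ∧ z.natAbs ≤ M ∧ (z % 2 = 0 ∨ z.natAbs ≤ m0))
  (hWge : ∀ m, ∃ x : ℕ → ℚ, (∀ j, L (x j)) ∧ W m = relErr φ x m)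
  (hq : φ.qexp ≤ -(G : ℤ)) (hR : (2 : ℚ) ^ (φ.manBits + E + 3) ≤ φ.maxRat)
  (hm0M : m0 ≤ M) (hMT : M ≤ 2 ^ (φ.manBits + 1)) (hm0 : 1 ≤ m0) (hME : M ≤ 2 ^ (G + E))
include hL hWge hq hR hm0M hMT hm0 hME

/-- THE LAW ROW on the whole first regime: `H_B` for every word of the alphabet, `Q ≥ M + 2`,
`k = d + 1 ≤ T/2` give `W(j₀+1+d) ≤ max((d+1)/(B+d+1), d/(T+d))`. [cell, gemm.tex Prop. p:fpL] -/
theorem gridW_le_firstRegimeLaw_all {j0 Bn Q d : ℕ} (hm : 1 ≤ φ.manBits)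
    (hj0 : M * j0 + m0 < 2 ^ (φ.manBits + 1))
    (hBall : ∀ x : ℕ → ℚ, (∀ j, L (x j)) → (∑ i ∈ range (j0 + 2), zl G x i) % 2 ≠ 0 →
      2 ^ (φ.manBits + 1) < (∑ i ∈ range (j0 + 2), zl G x i).natAbs →
      ((Bn : ℚ) + 1) / 2 ^ G ≤ ∑ i ∈ range (j0 + 2), |x i|)
    (hQ : M * (j0 + 2) + Q = 2 * 2 ^ (φ.manBits + 1)) (hQM : M + 2 ≤ Q)
    (hd : d + 1 ≤ 2 ^ φ.manBits) :
    W (j0 + 1 + d) ≤ max (((d + 1 : ℕ) : ℚ) / ((Bn : ℚ) + ((d + 1 : ℕ) : ℚ)))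
      ((d : ℚ) / (2 ^ (φ.manBits + 1) + d)) := by
  obtain ⟨x, hx, hW⟩ := hWge (j0 + 1 + d)
  rw [hW]
  exact relErr_le_firstRegimeLaw_all (fun j => hL _ (hx j)) hq hR hm0M hMT hm0 hME hm hj0
    (hBall x hx) hQ hQM hd

end RowsAll

section E2M1All

variable {φ : Format} (hm : 12 ≤ φ.manBits) (hq : φ.qexp ≤ -2)
  (hR : (2 : ℚ) ^ (φ.manBits + 10) ≤ φ.maxRat)
include hm hq hR

/-- UPPER HALF for E2M1², every precision `p ≥ 13`, on the whole first regime `k = d+1 ≤ 2^(p-1)`: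
with `144 j₀ + 9 < T`, `144(j₀+2) = B + 144`, `B ≤ T + 38`:
`W_φ(j₀+1+d) ≤ max((d+1)/(B+d+1), d/(T+d))`. [cell, gemm.tex Prop. p:fpP (v)] -/
theorem worstP_le_firstRegimeLaw_all {j0 Bn d : ℕ} (hj0 : 144 * j0 + 9 < 2 ^ (φ.manBits + 1))
    (hn : 144 * (j0 + 2) = Bn + 144) (hBn : Bn ≤ 2 ^ (φ.manBits + 1) + 38)
    (hd : d + 1 ≤ 2 ^ φ.manBits) :
    worstRelErrE2M1 φ (j0 + 1 + d) ≤ max (((d + 1 : ℕ) : ℚ) / ((Bn : ℚ) + ((d + 1 : ℕ) : ℚ)))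
      ((d : ℚ) / (2 ^ (φ.manBits + 1) + d)) := by
  have hT13 : 8192 ≤ 2 ^ (φ.manBits + 1) :=
    le_trans (by norm_num) (Nat.pow_le_pow_right (by norm_num) (by omega : 13 ≤ φ.manBits + 1))
  obtain ⟨Q, hQ⟩ : ∃ Q, 144 * (j0 + 2) + Q = 2 * 2 ^ (φ.manBits + 1) :=
    ⟨2 * 2 ^ (φ.manBits + 1) - 144 * (j0 + 2), by omega⟩
  exact gridW_le_firstRegimeLaw_all (L := fun q => q ∈ piE2M1) piE2M1_grid (worstP_specE φ).2 hq
    (E := 7) hR (by norm_num) (le_trans (by norm_num) hT13) (by norm_num) (by norm_num) (by omega)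
    hj0 (fun x hx => e2m1_entryMass hx hn hBn) hQ (by omega) hd

/-- THE EXACT FIRST-REGIME LAW OF E2M1² for `p ≡ 1 (mod 6)`, `p ≥ 13` (`144 j₀ + 128 = T`,
`n₀ = j₀ + 1`), on the WHOLE first regime: `W_φ(n₀ + k) = max(k/(T+16+k), (k-1)/(T+k-1))` for
every `1 ≤ k ≤ 2^(p-1)` (index `m = j₀ + 1 + d`, `k = d + 1`). [cell, gemm.tex Prop. p:fpP (v)] -/
theorem worstP_firstRegimeLaw_one_all {j0 : ℕ} (hj0 : 144 * j0 + 128 = 2 ^ (φ.manBits + 1))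
    {d : ℕ} (hd : d + 1 ≤ 2 ^ φ.manBits) :
    worstRelErrE2M1 φ (j0 + 1 + d)
      = max (((d + 1 : ℕ) : ℚ) / (2 ^ (φ.manBits + 1) + 16 + ((d + 1 : ℕ) : ℚ)))
        ((d : ℚ) / (2 ^ (φ.manBits + 1) + d)) := by
  have h7 : 7 ≤ φ.manBits := by omega
  have hup := worstP_le_firstRegimeLaw_all hm hq hR (j0 := j0) (Bn := 2 ^ (φ.manBits + 1) + 16)
    (d := d) (by omega) (by omega) (by omega) hd
  have hpl := le_worstP_plateau h7 hq hR (j0 := j0) (by omega) (by omega) (d + 1)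
  have hle := le_worstP_lateEntry h7 hq hR (j0 := j0) (C := 64) (D := 64) (by norm_num [piE2M1])
    (by norm_num [piE2M1]) (by omega) (by omega) d
  have e144 : (144 : ℚ) * (j0 + 1) = 2 ^ (φ.manBits + 1) + 16 := by
    exact_mod_cast (show 144 * (j0 + 1) = 2 ^ (φ.manBits + 1) + 16 by omega)
  rw [show j0 + (d + 1) = j0 + 1 + d by ring, e144] at hpl
  push_cast at hup hpl hle ⊢
  exact le_antisymm hup (max_le hpl hle)

/-- THE EXACT FIRST-REGIME LAW OF E2M1² for `p ≡ 2 (mod 6)`, `p ≥ 14` (`144 j₀ + 112 = T`,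
`n₀ = j₀ + 1`), on the WHOLE first regime: `W_φ(n₀ + k) = max(k/(T+32+k), (k-1)/(T+k-1))` for
every `1 ≤ k ≤ 2^(p-1)`. [cell, gemm.tex Prop. p:fpP (v)] -/
theorem worstP_firstRegimeLaw_two_all {j0 : ℕ} (hj0 : 144 * j0 + 112 = 2 ^ (φ.manBits + 1))
    {d : ℕ} (hd : d + 1 ≤ 2 ^ φ.manBits) :
    worstRelErrE2M1 φ (j0 + 1 + d)
      = max (((d + 1 : ℕ) : ℚ) / (2 ^ (φ.manBits + 1) + 32 + ((d + 1 : ℕ) : ℚ)))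
        ((d : ℚ) / (2 ^ (φ.manBits + 1) + d)) := by
  have h7 : 7 ≤ φ.manBits := by omega
  have hup := worstP_le_firstRegimeLaw_all hm hq hR (j0 := j0) (Bn := 2 ^ (φ.manBits + 1) + 32)
    (d := d) (by omega) (by omega) (by omega) hd
  have hpl := le_worstP_plateau h7 hq hR (j0 := j0) (by omega) (by omega) (d + 1)
  have hle := le_worstP_lateEntry h7 hq hR (j0 := j0) (C := 64) (D := 48) (by norm_num [piE2M1])
    (by norm_num [piE2M1]) (by omega) (by omega) d
  have e144 : (144 : ℚ) * (j0 + 1) = 2 ^ (φ.manBits + 1) + 32 := by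
    exact_mod_cast (show 144 * (j0 + 1) = 2 ^ (φ.manBits + 1) + 32 by omega)
  rw [show j0 + (d + 1) = j0 + 1 + d by ring, e144] at hpl
  push_cast at hup hpl hle ⊢
  exact le_antisymm hup (max_le hpl hle)

end E2M1All

/-- THE EXACT FIRST-REGIME LAW OF E2M3·E2M1 INTO binary32 (`p = 24`) on the WHOLE first regime:
`W_24(n₀ + k) = max(k/(2^24+4+k), (k-1)/(2^24+k-1))` for every `1 ≤ k ≤ 2^23` (`n₀ = 23302`;
index `m = 23302 + d`, `k = d + 1`). [cell, gemm.tex Prop. p:fpA (v)] -/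
theorem worst4P_Binary32_law_all {d : ℕ} (hd : d + 1 ≤ 2 ^ 23) :
    worstRelErrMixA Format.Binary32 (23302 + d)
      = max (((d + 1 : ℕ) : ℚ) / (2 ^ 24 + 4 + ((d + 1 : ℕ) : ℚ))) ((d : ℚ) / (2 ^ 24 + d)) := by
  obtain ⟨h1, h2, h3, h4⟩ := Binary32_hyps4
  have hT : 2 ^ (Format.Binary32.manBits + 1) = 16777216 := by rw [pow_succ, h4]; norm_num
  have hup := gridW_le_firstRegimeLaw_all piMixA_grid (worst4P_spec Format.Binary32).2 h2 (E := 9)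
    h3 (by norm_num) (mixA_MT h1) (by norm_num) (by norm_num) (j0 := 23301) (Bn := 16777220)
    (Q := 16776272) (d := d) (by omega) (by omega)
    (by rw [hT]; exact fun x hx => mixA_entryMass_Binary32 hx) (by omega) (by omega)
    (by rw [h4]; omega)
  rw [show (23301 : ℕ) + 1 + d = 23302 + d by ring,
    show Format.Binary32.manBits + 1 = 24 from rfl] at hup
  refine le_antisymm (le_trans hup (le_of_eq ?_))
    (max_le (worst4P_Binary32_entry d) (worst4P_Binary32_late d))
  norm_num

/-- THE EXACT FIRST-REGIME LAW OF E3M2·E2M1 INTO binary32 (`p = 24`) on the WHOLE first regime: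
`W_24(n₀ + k) = max(k/(2^24+512+k), (k-1)/(2^24+k-1))` for every `1 ≤ k ≤ 2^23` (`n₀ = 3121`;
index `m = 3121 + d`, `k = d + 1`). [cell, gemm.tex Prop. p:fpA (v)] -/
theorem worst5P_Binary32_law_all {d : ℕ} (hd : d + 1 ≤ 2 ^ 23) :
    worstRelErrMixB Format.Binary32 (3121 + d)
      = max (((d + 1 : ℕ) : ℚ) / (2 ^ 24 + 512 + ((d + 1 : ℕ) : ℚ))) ((d : ℚ) / (2 ^ 24 + d)) := by
  obtain ⟨h1, h2, h3, h4⟩ := Binary32_hyps5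
  have hT : 2 ^ (Format.Binary32.manBits + 1) = 16777216 := by rw [pow_succ, h4]; norm_num
  have hup := gridW_le_firstRegimeLaw_all piMixB_grid (worst5P_spec Format.Binary32).2 h2
    (E := 12) h3 (by norm_num) (mixB_MT h1) (by norm_num) (by norm_num) (j0 := 3120)
    (Bn := 16777728) (Q := 16770560) (d := d) (by omega) (by omega)
    (by rw [hT]; exact fun x hx => mixB_entryMass_Binary32 hx) (by omega) (by omega)
    (by rw [h4]; omega)
  rw [show (3120 : ℕ) + 1 + d = 3121 + d by ring,
    show Format.Binary32.manBits + 1 = 24 from rfl] at hup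
  refine le_antisymm (le_trans hup (le_of_eq ?_))
    (max_le (worst5P_Binary32_entry d) (worst5P_Binary32_late d))
  norm_num

end Summit.Ventures.CertifiedArithmetic.LowPrec.Gemm
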